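/-
Copyright (c) 2026. All rights reserved.
Released under Apache 2.0 license as described in the file LICENSE.
Authors: abc-iut cell, prover seat abc-iut-w5-d053 (gen 5; row «MTC-EMPTY-AT-MONOAN», yielded by abc-iut-f-101 gen 4, whose
2026-08-26T22:24Z finding this certifies), over abc-iut-w6-d036's / abc-iut-w4-d095's genuine mono-analytic §5 settings,
abc-iut-L4-t3's telecore add-on and this seat's gen-4 affine witness `𝒳_{P₀}` (see the imports).
-/
import Literature.AnabelianGeometry.AbsoluteAnabelian.LogFrobeniusMonoGenuineProp58viiPfOpen
import Literature.AnabelianGeometry.AbsoluteAnabelian.AbsTopIII.MLFGaloisModelAffineWitness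
import Literature.AnabelianGeometry.AbsoluteAnabelian.MLFAbsoluteGaloisGroupInfinite
import HarnessLib

/-!
# [AbsTopIII] Cor 5.10 (iv)(b)(c): abc-iut-L4-t3's telecore add-on `MonoTelecoreCoherence` is EMPTY at the UNRESTRICTED
# genuine mono-analytic MLF settings (`nonarchGenuineMonoAn`, `nonarchGenuineMonoAnPf`) — the augmentation-topology obstruction

S. Mochizuki, *Topics in absolute anabelian geometry III*, J. Math. Sci. Univ. Tokyo 22 (2015) [MochizukiAbsTopIII2015];
locators = pages of the kurims manuscript (`paper:url-5493eb38cbb7`): Def 3.1 (i) p. 66 ("a topological group `Π_k`, equipped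
with a continuous surjection `ε_k : Π_k ↠ G_k`"), Def 5.6 (iii) p. 136, Prop 5.8 (vii) pp. 141–142, Cor 5.10 (iv)(c) p. 148
(the natural isomorphisms `η⊢_{v,ν}`).

## The finding (abc-iut-f-101 gen 4, «MTC-EMPTY-AT-MONOAN», 2026-08-26T22:24Z), certified here

At abc-iut-w6-d036's setting `LogFrobeniusSetting.nonarchGenuineMonoAn p Vmod isArc` (and abc-iut-w4-d095's re-pointed
`nonarchGenuineMonoAnPf`, whose holomorphic rows and whose `ψ^{An⊢⊞}` at the vertex `𝒪^×` are the same) the field `eta` of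
abc-iut-L4-t3's add-on `MonoTelecoreCoherence M` asks, at a nonarchimedean place `v` and the cross vertex `𝒪^×`, for a natural
isomorphism of functors `𝒳 ⥤ 𝒩⊢⊞_v = Up (MonoBase × 𝒞_TS)` whose `𝒞_TS`-component at a model object `A` is an ISOMORPHISM of
`TS`-pairs `(G_{k_A} ↷ 𝒪^×_{ℚ̄_p}) ≅ (Π_A ⧸ Ker(Π_A ↷ 𝒪^×) ↷ 𝒪^×)`; its Galois component is a CONTINUOUS INJECTIVE homomorphism from
`Gal(ℚ̄_p/k_A)` (Krull topology: compact, infinite) to `Π_A ⧸ Ker` (QUOTIENT topology of `Π_A`).  The typed Def 3.1 (i)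
(`TFModel p`, abc-iut-L4-t9) allows `Π_A` DISCRETE — e.g. this seat's gen-4 affine witness `affineModel k = (Π₀(k) ↠ G_k ↷ ℚ̄_p)`
with `Π₀(k)` discrete — and then `Π_A ⧸ Ker` is discrete, so no such map exists (a compact space injecting continuously into a
discrete one is finite).  Hence:

* `LogFrobeniusSetting.nonarchGenuineMonoAn_isEmpty_monoTelecoreCoherence` /
  `LogFrobeniusSetting.nonarchGenuineMonoAnPf_isEmpty_monoTelecoreCoherence` — for EVERY mono-analyticization datum `M` and
  every index set with a nonarchimedean place, `IsEmpty (….MonoTelecoreCoherence M)`;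
* `AbsTopIII.TFModel.not_isOpenAug_affineModel` — the affine witness is NOT in the open-augmentation sub-model `𝒳^{open}`
  (abc-iut-w5-d053 gen 5, `MLFGaloisModelOpenAug.lean`), consistently: on `𝒳^{open}` the comparison isomorphisms DO exist
  (abc-iut-f-101's `LogFrobeniusMonoEtaComponents.lean`, `augQuotientIso`) and the positive carrier is the restricted setting
  `nonarchGenuineMonoAnPfOpen` (row «MTC-GENUINE-POSITIVE-OPENAUG»).

Tools: `AbsTopIII.infinite_galois_intermediateField` (`Gal(ℚ̄_p/k)` is infinite for `k/ℚ_p` finite — abc-iut-L4's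
`IsMLF.infinite_absoluteGaloisGroup` transported along `IsAlgClosure.equiv`), `not_injective_of_continuous_of_compact_of_discrete`.

HONEST FRAMING: a NEGATIVE about the TYPED, UNRESTRICTED model (Def 3.1 (i) verbatim allows non-open `ε_k`); print's `Π_k = Π_X`
is profinite, where `ε_k` is automatically open (`TFModel.isOpenAug_of_compactSpace`) — nothing about print is impugned;
refereed pre-IUT material; nothing here bears on [IUTchIII] Cor. 3.12; no side taken; typed ≠ proved elsewhere; model-level.
-/

set_option autoImplicit false

noncomputable section

open CategoryTheory Topology

namespace Literature.AnabelianGeometry.AbsoluteAnabelian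

open AbsTopIII

/-! ## Part 1. Two topological inputs -/

/-- A continuous map from a compact INFINITE space to a discrete space is not injective (its image is compact and discrete,
hence finite). [cite: MochizukiAbsTopIII2015, Definition 3.1 (i) p.66] -/
theorem not_injective_of_continuous_of_compact_of_discrete {X Y : Type*} [TopologicalSpace X] [CompactSpace X]
    [Infinite X] [TopologicalSpace Y] [DiscreteTopology Y] (f : X → Y) (hf : Continuous f) : ¬ Function.Injective f := by
  intro hinj
  have hfin : (Set.range f).Finite := (isCompact_range hf).finite_of_discrete
  have huniv : (Set.univ : Set X).Finite := by
    have := hfin.preimage hinj.injOn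
    rwa [Set.preimage_range] at this
  exact Set.infinite_univ huniv

namespace AbsTopIII

variable {p : ℕ} [Fact p.Prime]

/-- **`Gal(ℚ̄_p/k)` is infinite** for every `ℚ_p ⊆ k ⊆ ℚ̄_p` finite over `ℚ_p` (abc-iut-L4's `IsMLF.infinite_absoluteGaloisGroup` for
the MLF `k`, transported from `AlgebraicClosure k` to `ℚ̄_p` along `IsAlgClosure.equiv`).
[cite: MochizukiAbsTopIII2015, Definition 3.1 (i) p.66] -/
theorem infinite_galois_intermediateField (k : IntermediateField ℚ_[p] (PadicAlgCl p)) [FiniteDimensional ℚ_[p] k] :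
    Infinite (PadicAlgCl p ≃ₐ[k] PadicAlgCl p) := by
  have hK : IsMLF k := by
    refine ⟨⟨p, inferInstance, algebraMap ℚ_[p] k, ?_⟩⟩
    have halg : (algebraMap ℚ_[p] k).toAlgebra = (inferInstance : Algebra ℚ_[p] k) :=
      Algebra.algebra_ext _ _ fun _ => rfl
    rw [halg]
    infer_instance
  have hinf : Infinite (AlgebraicClosure k ≃ₐ[k] AlgebraicClosure k) := hK.infinite_absoluteGaloisGroup
  haveI := PadicAlgCl.isAlgClosure_subfield k
  let e : AlgebraicClosure k ≃ₐ[k] PadicAlgCl p := IsAlgClosure.equiv k (AlgebraicClosure k) (PadicAlgCl p)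
  exact @Infinite.of_injective _ _ hinf e.autCongr e.autCongr.injective

namespace TFModel

/-- The arithmetic quotient of this seat's affine witness `affineModel k` (`Π₀(k)` DISCRETE) by ANY normal subgroup is discrete.
[cite: MochizukiAbsTopIII2015, Definition 3.1 (i) p.66] -/
theorem discreteTopology_affineModel_quotient (k : IntermediateField ℚ_[p] (PadicAlgCl p)) [FiniteDimensional ℚ_[p] k]
    (N : Subgroup (affineModel k).pair.Pi) [N.Normal] : DiscreteTopology ((affineModel k).pair.Pi ⧸ N) := by
  haveI : DiscreteTopology (affineModel k).pair.Pi := inferInstanceAs (DiscreteTopology (AffPi k))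
  rw [discreteTopology_iff_isOpen_singleton]
  intro x
  induction x using QuotientGroup.induction_on with
  | H g =>
    have h : ({(QuotientGroup.mk g : (affineModel k).pair.Pi ⧸ N)} : Set _) = QuotientGroup.mk '' {g} := by
      rw [Set.image_singleton]
    rw [h]
    exact QuotientGroup.isOpenMap_coe _ (isOpen_discrete _)

/-- **The affine witness is NOT in the open-augmentation sub-model**: `ε : Π₀(k) ↠ G_k` from a discrete group onto the infinite
compact `G_k` is not open (the image `{1}` of the open `{1}` is not open in an infinite Hausdorff compact group).
[cite: MochizukiAbsTopIII2015, Definition 3.1 (i) p.66] -/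
theorem not_isOpenAug_affineModel (k : IntermediateField ℚ_[p] (PadicAlgCl p)) [FiniteDimensional ℚ_[p] k] :
    ¬ IsOpenAug (affineModel k) := by
  intro h
  haveI : Algebra.IsAlgebraic k (PadicAlgCl p) := (affineModel k).isAlgebraic
  haveI := infinite_galois_intermediateField (p := p) k
  -- `ε` open quotient from a DISCRETE group ⇒ `G_k` discrete ⇒ (compact) finite — contradiction
  have hq : IsOpenQuotientMap (affineModel k).D.aug := IsOpenAug.isOpenQuotientMap h
  haveI : DiscreteTopology (affineModel k).D.Pi := inferInstanceAs (DiscreteTopology (AffPi k))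
  have hdisc : DiscreteTopology (PadicAlgCl p ≃ₐ[k] PadicAlgCl p) := by
    rw [discreteTopology_iff_isOpen_singleton]
    intro σ
    obtain ⟨g, rfl⟩ := (affineModel k).D.aug_surjective σ
    have : IsOpen ((affineModel k).D.aug '' {g}) := hq.isOpenMap _ (isOpen_discrete _)
    rwa [Set.image_singleton] at this
  exact not_injective_of_continuous_of_compact_of_discrete
    (id : (PadicAlgCl p ≃ₐ[k] PadicAlgCl p) → (PadicAlgCl p ≃ₐ[k] PadicAlgCl p)) continuous_id Function.injective_id

end TFModel

end AbsTopIII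

/-! ## Part 2. The `η⊢`-type at `𝒪^×` is EMPTY at the unrestricted genuine mono-analytic settings -/

namespace LogFrobeniusSetting

variable (p : ℕ) [Fact p.Prime] (Vmod : Type 1) (isArc : Vmod → Bool)

/-- **The core obstruction**: for ANY container family reading abc-iut-w6-d036's `(G_k ↷ 𝒪^×_k̄)` at the vertex `𝒪^×` of a
nonarchimedean place (true of `ψMono` and `ψMonoPf`), the `η⊢`-type at `𝒪^×` is EMPTY — evaluate a putative `η` at the affine
witness `𝒳_{P₀}` over `ℚ_p` (`Π₀(ℚ_p)` discrete) and read the Galois component: a continuous injection of the infinite compact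
`Gal(ℚ̄_p/ℚ_p)` into the discrete `Π₀ ⧸ Ker`. [cite: MochizukiAbsTopIII2015, Cor 5.10 (iv)(c) p. 148] -/
theorem isEmpty_etaTypeAt_units (ψ : (b : Bool) → LogVertex b → (MLFClosure.AnMono ⥤ MLFClosure.MonoBase × TSObj))
    (hψ : ψ false NonarchVertex.units = MLFClosure.ψMono false NonarchVertex.units) :
    IsEmpty (nonarchLam p false NonarchVertex.units ⋙ 𝟭 (Up (TFModel p × TSObj)) ⋙ Up.liftF (CategoryTheory.Prod.fst (TFModel p) TSObj) ⋙
        Up.liftF (TFModel.toMonoBase p) ⋙ (Up.liftE MLFClosure.anMonoEquiv).functor ⋙ Up.liftF (ψ false NonarchVertex.units) ≅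
      nonarchLam p false NonarchVertex.units ⋙ nonarchMonoNAn p) := by
  rw [hψ]
  refine ⟨fun e => ?_⟩
  -- the affine witness over `ℚ_p` as an object of `𝒳`
  let x₀ : Up (TFModel p) := ULift.up (TFModel.affineModel (⊥ : IntermediateField ℚ_[p] (PadicAlgCl p)))
  -- the component at `x₀`, projected to the local `TS`-pairs
  let η := (inducedFunctor (ULift.down : ULift.{2} (MLFClosure.MonoBase × TSObj) → MLFClosure.MonoBase × TSObj) ⋙
    CategoryTheory.Prod.snd MLFClosure.MonoBase TSObj).mapIso (e.app x₀)
  -- its Galois component: `Gal(ℚ̄_p/ℚ_p) → Π₀ ⧸ Ker`, continuous and injective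
  have hcont : Continuous (η.hom : TSObj.Hom _ _).homPi := (η.hom : TSObj.Hom _ _).continuous_homPi
  have hinj : Function.Injective (η.hom : TSObj.Hom _ _).homPi := (η.hom : TSObj.Hom _ _).bijective_homPi.1
  haveI : Algebra.IsAlgebraic (⊥ : IntermediateField ℚ_[p] (PadicAlgCl p)) (PadicAlgCl p) :=
    (TFModel.affineModel (p := p) ⊥).isAlgebraic
  haveI : Infinite (PadicAlgCl p ≃ₐ[(⊥ : IntermediateField ℚ_[p] (PadicAlgCl p))] PadicAlgCl p) :=
    AbsTopIII.infinite_galois_intermediateField (p := p) ⊥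
  exact @not_injective_of_continuous_of_compact_of_discrete _ _ _
    (inferInstanceAs (CompactSpace (PadicAlgCl p ≃ₐ[(⊥ : IntermediateField ℚ_[p] (PadicAlgCl p))] PadicAlgCl p)))
    (inferInstanceAs (Infinite (PadicAlgCl p ≃ₐ[(⊥ : IntermediateField ℚ_[p] (PadicAlgCl p))] PadicAlgCl p)))
    _ (@TFModel.discreteTopology_affineModel_quotient p _ (⊥ : IntermediateField ℚ_[p] (PadicAlgCl p)) _ _
        (TSObj.actionKer_normal _)) _ hcont hinj

/-- At a nonarchimedean place there is a cross vertex (`𝒪^×`) whose `η⊢`-type is empty, for both container families.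
[cite: MochizukiAbsTopIII2015, Cor 5.10 (iv)(c) p. 148] -/
theorem exists_isEmpty_etaTypeAt (ψ : (b : Bool) → LogVertex b → (MLFClosure.AnMono ⥤ MLFClosure.MonoBase × TSObj))
    (hψ : ψ false NonarchVertex.units = MLFClosure.ψMono false NonarchVertex.units) (b : Bool) (hb : b = false) :
    ∃ (ν : LogVertex b) (_ : ν.IsCross), IsEmpty (nonarchLam p b ν ⋙ 𝟭 (Up (TFModel p × TSObj)) ⋙ Up.liftF (CategoryTheory.Prod.fst (TFModel p) TSObj) ⋙
        Up.liftF (TFModel.toMonoBase p) ⋙ (Up.liftE MLFClosure.anMonoEquiv).functor ⋙ Up.liftF (ψ b ν) ≅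
      nonarchLam p b ν ⋙ nonarchMonoNAn p) := by
  subst hb
  exact ⟨NonarchVertex.units, ⟨rfl, rfl⟩, isEmpty_etaTypeAt_units p ψ hψ⟩

/-- **`MonoTelecoreCoherence` is EMPTY at abc-iut-w6-d036's `nonarchGenuineMonoAn p`** — every mono-analyticization datum `M`,
every index set with a nonarchimedean place `v₀`: the field `eta v₀ 𝒪^×` cannot exist.
[cite: MochizukiAbsTopIII2015, Cor 5.10 (iv)(c) p. 148] -/
theorem nonarchGenuineMonoAn_isEmpty_monoTelecoreCoherence
    (M : (nonarchGenuineMonoAn p Vmod isArc).MonoAnalyticizationHomotopies) (v₀ : Vmod) (hv₀ : isArc v₀ = false) :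
    IsEmpty ((nonarchGenuineMonoAn p Vmod isArc).MonoTelecoreCoherence M) := by
  obtain ⟨ν, hν, h⟩ := exists_isEmpty_etaTypeAt p MLFClosure.ψMono rfl (isArc v₀) hv₀
  exact ⟨fun K => h.false (K.eta v₀ ν hν)⟩

/-- **`MonoTelecoreCoherence` is EMPTY at abc-iut-w4-d095's re-pointed `nonarchGenuineMonoAnPf p`** (genuine perfection
vertices do not help: the obstruction sits at `𝒪^×`, where `ψMonoPf = ψMono`).
[cite: MochizukiAbsTopIII2015, Cor 5.10 (iv)(c) p. 148] -/
theorem nonarchGenuineMonoAnPf_isEmpty_monoTelecoreCoherence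
    (M : (nonarchGenuineMonoAnPf p Vmod isArc).MonoAnalyticizationHomotopies) (v₀ : Vmod) (hv₀ : isArc v₀ = false) :
    IsEmpty ((nonarchGenuineMonoAnPf p Vmod isArc).MonoTelecoreCoherence M) := by
  obtain ⟨ν, hν, h⟩ := exists_isEmpty_etaTypeAt p MLFClosure.ψMonoPf rfl (isArc v₀) hv₀
  exact ⟨fun K => h.false (K.eta v₀ ν hν)⟩

/-- In particular the PINNED Cor 5.10 (iv)(b)(c) sufficiency package over `(M, K)` (abc-iut-f-101's `cor510MonoTelecorePinned_of`)
has NO input `K` at the unrestricted settings over a purely nonarchimedean index set — whereas Cor 5.10 (iv)(a) holds there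
(`nonarchGenuineMonoAnPf_cor510MonoCores`): the contrast in one line. [cite: MochizukiAbsTopIII2015, Cor 5.10 (iv) pp. 147–148] -/
theorem nonarchGenuineMonoAnPf_cores_and_isEmpty_coherence (v₀ : Vmod) (hv₀ : isArc v₀ = false) :
    (nonarchGenuineMonoAnPf p Vmod isArc).Cor510MonoCores ∧
      ∀ M : (nonarchGenuineMonoAnPf p Vmod isArc).MonoAnalyticizationHomotopies,
        IsEmpty ((nonarchGenuineMonoAnPf p Vmod isArc).MonoTelecoreCoherence M) :=
  haveI : Nonempty Vmod := ⟨v₀⟩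
  ⟨nonarchGenuineMonoAnPf_cor510MonoCores p Vmod isArc,
    fun M => nonarchGenuineMonoAnPf_isEmpty_monoTelecoreCoherence p Vmod isArc M v₀ hv₀⟩

/-- **Why the open-augmentation sub-model is the right carrier** (contrast, by name): the affine witness that kills `η⊢` above
is NOT an object of `𝒳^{open}` (`not_isOpenAug_affineModel`), every object of the restricted setting's `𝒳` has open
augmentation (`nonarchGenuineMonoAnPfOpen_isOpenMap_aug`), and `𝒳^{open}` is inhabited.
[cite: MochizukiAbsTopIII2015, Definition 3.1 (i) p.66] -/
theorem openAug_contrast :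
    ¬ TFModel.IsOpenAug (TFModel.affineModel (⊥ : IntermediateField ℚ_[p] (PadicAlgCl p))) ∧
      (∀ A : (nonarchGenuineMonoAnPfOpen p Vmod isArc).X, IsOpenMap A.down.obj.D.aug) ∧ Nonempty (TFModelOpen p) :=
  ⟨TFModel.not_isOpenAug_affineModel ⊥, nonarchGenuineMonoAnPfOpen_isOpenMap_aug p Vmod isArc, TFModelOpen.nonempty p⟩

end LogFrobeniusSetting

end Literature.AnabelianGeometry.AbsoluteAnabelian

end
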